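import Summits.BirchSwinnertonDyer.BirchSwinnertonDyer.Theorems.KolyvaginRoadThreeSchneiderTamAtThreeHeightLogNumeratorSecondOrderCriterion
import Summits.BirchSwinnertonDyer.BirchSwinnertonDyer.Theses.KolyvaginRoadThree
import HarnessLib

/-!
# Crux `SchneiderTamAtThree` (item 19154) — THE HEIGHT IS THE LOGARITHM OF THE NUMERATOR, SECOND ORDER,
# part 3b: the crux on the second-order numerator sub-locus (crux named by name; imports the route file)

HONEST FRAMING (cell `bsd-stepL`, seat `bsd-stepL-tam3-p2` g2, WIDTH-LEVER second lane «closed-form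
Schneider local factor at 3 … finite case table proved once»; `--supports stmt-BirchSwinnertonDyer-19154
--as helper`): THEOREMS ONLY; 0 definitions, 0 named facts, 0 sorry; nothing here proves the crux
class-wide, Schneider's conjecture or BSD — the crux stays OPEN (class-wide it is the transcendence-type
statement `Σ²_E(P) ≠ den x(P)` on every admissible point of every curve of the locus, companion file
`KolyvaginRoadThreeSchneiderTamAtThreeOfTateSigma.lean`). This thin file only names the crux; all the
mathematics is in the route-free parts 1, 2a, 2b, 3 (`…HeightLogNumeratorSecondOrder{Series,Core,,Criterion}`).

* `regulatorNonvanishingAt_three_of_classX11b_of_num_criterion₂` — for `W` of class X11b at `3`,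
  non-split at `3`, with an admissible rational point passing the SECOND-ORDER numerator criterion
  `3^{v₃(den x)+1} ∤ c₄((num x)³ − num x) + 2b₂b₄·den x`: `RegulatorNonvanishingAt W 3` (GZK by name for
  the rank).
* `schneiderTamAtThree_of_num_witnesses₂` — the crux ⟸ one second-order witness per curve of the locus
  (the first-order version, part 4 of the first chain, is the special case `3^{v₃ den x} ∤ (num x)² − 1`;
  on lane A's table of record the second-order witness exists for the tabulated point in 650 of 690 rows
  against 543).

References: [SteinWuthrich2013] §4.2, Conj. 4.1; [Schneider1982PadicHeightI] §1;
[KolyvaginEulerSystems1990] Thm. A; tree: part 3 (`…SecondOrderCriterion`), part 4 of the first chain.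
-/

noncomputable section

open scoped Classical
open WeierstrassCurve Literature.NumberTheory.EllipticCurves
open Literature.NumberTheory.EllipticCurves.SteinWuthrich2013
open Literature.NumberTheory.EllipticCurves.Rank1Residual
open Summit.BirchSwinnertonDyer.Uniform.UI.O2

namespace Summit.BirchSwinnertonDyer.Rank1Residual.X11b.RegMult.HeightLogNumerator

section Crux

variable {W : WeierstrassCurve ℚ}

/-- **The crux `SchneiderTamAtThree` ON THE SECOND-ORDER NUMERATOR SUB-LOCUS is a theorem** (given GZK by
name for rank one): for every `W` of class X11b at `3` (`r_an = 1`, `3 ∥ N`, `E[3]` irreducible),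
non-split at `3`, possessing an admissible rational point `P = (x, y)` with
`3^{v₃(den x)+1} ∤ c₄·((num x)³ − num x) + 2b₂b₄·den x` (`b₂, b₄, c₄` of the minimal model),
`RegulatorNonvanishingAt W 3`. On lane A's table of record (kit j249075: 690 TRUE-OPEN non-split (ram)
X11b@3 rows with point data) the tabulated admissible point satisfies this in 650 rows (first order: 543);
the remaining 40 rows (`v₃(ĥ₃(Q)) > v₃(den x(Q))`) are where the height is divisible beyond its second
digit. (The (ram) and Tamagawa binders of the crux are not used.) [cite: SteinWuthrich2013, §4.2, Conj. 4.1]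
[cite: KolyvaginEulerSystems1990, Thm. A] -/
theorem regulatorNonvanishingAt_three_of_classX11b_of_num_criterion₂
    (hGZK : rank_eq_analyticRank_of_analyticRank_le_one) (W : WeierstrassCurve ℚ) [W.IsElliptic]
    [W.IsGloballyMinimal] (hX : Summit.BirchSwinnertonDyer.Rank1Residual.ClassX11b W 3)
    (hns : ¬ W.HasSplitMultiplicativeReductionAtPrime 3)
    {x y : ℚ} {h : W.toAffine.Nonsingular x y} (hadm : W.IsAdmissible 3 (.some x y h)) {N : ℤ}
    (hN : W.c₄ * ((x.num : ℚ) ^ 3 - x.num) + 2 * W.b₂ * W.b₄ * (x.den : ℚ) = (N : ℚ))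
    (hcrit : ¬ ((3 : ℤ) ^ (padicValNat 3 x.den + 1) ∣ N)) :
    X11b.ClassClosure.RegulatorNonvanishingAt W 3 :=
  regulatorNonvanishingAt_three_of_num_criterion₂ hX.2.2.1 hns (by rw [(hGZK W hX.1.le).1, hX.1]) hadm hN
    hcrit

/-- **`SchneiderTamAtThree` ⟸ one SECOND-ORDER numerator witness per curve** (given GZK): if every curve
of the crux's locus (`ClassX11b W 3`, (ram), non-split at `3`, `3 ∣ ∏ c_ℓ`) has an admissible rational
point `(x, y)` and an integer `N = c₄((num x)³ − num x) + 2b₂b₄·den x` with `3^{v₃(den x)+1} ∤ N`, the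
crux holds. CONDITIONAL on the witness hypothesis `hwit` — a statement about rational points of infinitely
many curves (true for the tabulated point on 650/690 = 94 % of the tabulated classes) — recorded as the
exact shape of what the second `3`-adic digit of the «finite case table» contributes to this crux; the
table continues digit by digit (the transcendental constant `s = E₂(q)/(12C²)` of the closed form agrees
with `−c₆/(12c₄)` to `v₃(Δ) + 1` digits, kit j281722), but no bounded depth closes the class.
[cite: SteinWuthrich2013, §4.2, Conj. 4.1] [cite: KolyvaginEulerSystems1990, Thm. A] -/
theorem schneiderTamAtThree_of_num_witnesses₂ (hGZK : rank_eq_analyticRank_of_analyticRank_le_one)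
    (hwit : ∀ (W : WeierstrassCurve ℚ) [W.IsElliptic] [W.IsGloballyMinimal],
      Summit.BirchSwinnertonDyer.Rank1Residual.ClassX11b W 3 →
      Literature.NumberTheory.EllipticCurves.Rank1Residual.Ram W 3 →
      ¬ W.HasSplitMultiplicativeReductionAtPrime 3 → 3 ∣ W.tamagawaProduct →
      ∃ (x y : ℚ) (h : W.toAffine.Nonsingular x y) (N : ℤ), W.IsAdmissible 3 (.some x y h) ∧
        W.c₄ * ((x.num : ℚ) ^ 3 - x.num) + 2 * W.b₂ * W.b₄ * (x.den : ℚ) = (N : ℚ) ∧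
        ¬ ((3 : ℤ) ^ (padicValNat 3 x.den + 1) ∣ N)) :
    Summit.BirchSwinnertonDyer.BirchSwinnertonDyer.Theses.KolyvaginRoadThree.SchneiderTamAtThree := by
  intro W _ _ hX hram hns htam
  obtain ⟨x, y, h, N, hadm, hN, hcrit⟩ := hwit W hX hram hns htam
  exact regulatorNonvanishingAt_three_of_classX11b_of_num_criterion₂ hGZK W hX hns hadm hN hcrit

end Crux

end Summit.BirchSwinnertonDyer.Rank1Residual.X11b.RegMult.HeightLogNumerator

end
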